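import Summits.HodgeConjecture.HodgeConjecture.Theorems.PadicSemiregularLiftHodgeFermatVarietiesSigmaFiveOfFibre
import HarnessLib

/-!
# Hodge octuples at a level prime to `6`: six points of a `7`-progression force Aoki's `σ_{7,A}` — stub G8-L3 `stub_sigmaSeven_of_fibre` of line `cancel-by-any-claim-lattice`, crux `HodgeFermatVarieties` (stmt-HodgeConjecture-1334)

Crux `HodgeFermatVarieties` (stmt-HodgeConjecture-1334), line `cancel-by-any-claim-lattice`, stub G8-L3
`stub_sigmaSeven_of_fibre` (worker file). Everything here is PROVED (no `sorry`, no new definition, no new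
named fact). This is the file `…SigmaFiveOfFibre` with `5 ↦ 7`; it reuses that file's bookkeeping
(`CoprimeSix.isHodgeMultiset_map_neg`, `CoprimeSix.exists_pairing_of_four`).

The lead's programme G8 classifies the Hodge OCTUPLES `s` of `ℤ/m`, `(m, 30) = 1`, `49 ∤ m`: four pairs, or
Aoki's standard element `σ_{7,A} = {A + j·e : j < 7} + {-7A}`, `e = m/7`, `7A ≠ 0`. A level analysis (stub
G8-L2) produces six of the seven progression points `A + j e` inside `s`; THIS file finishes:

* `stub_sigmaSeven_of_fibre` (registered signature): if a Hodge octuple `s` of level `m` coprime to `6`,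
  `7 ∣ m`, contains the points `A + j(m/7)`, `j < 7`, `j ≠ j₀` (`7A ≠ 0`), then `s` is four pairs or
  `s = {A + j(m/7) : j < 7} + {-7A}` (in fact always the latter).

Proof. The standard multiset `σ = {A + j e : j < 7} + {-7A}` is a Hodge multiset
(`isHodgeMultiset_pStandard`, Aoki 1983 Prop. 5.1 with `p = 7 = 2·3+1`), hence so is its negative
(`isHodgeMultiset_map_neg`) and `s + (-σ)` (a Hodge 16-multiset). The six progression points `F₆ ⊂ s` are
pairwise distinct (the progression is the fibre of reduction mod `m/7`, `range_map_eq_filter_of_dvd_one`), so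
`s = F₆ + {u₁, u₂}` and `s + (-σ) = (F₆ + (-F₆)) + {u₁, u₂, -(A + j₀ e), 7A}`; cancelling the pairs
(`isHodgeMultiset_add_map_neg`, `IsHodgeMultiset.of_add_left`) leaves a Hodge QUADRUPLE, which by the surface
theorem of Aoki–Shioda 1983 (`(𝔅²ₘ) (i)`, `(m, 6) = 1`, DISCHARGED in the tree:
`AokiShioda1983_thmB2m_coprime_six_holds`) splits into two pairs (`exists_pairing_of_four`). If `-(A + j₀ e)`
pairs with `7A` then `7A = A + j₀ e`, so `42A = 7 j₀ e = 0` and `7A = 0` (`6` is a unit mod `m`,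
`(m, 6) = 1`) — excluded; otherwise `{u₁, u₂} = {A + j₀ e, -7A}` and `s = σ`. In particular the LEFT
disjunct of the registered conclusion never occurs under the hypotheses; it is kept because the signature is
registered verbatim.

References: [AokiShioda1983] N. Aoki, T. Shioda, Generators of the Néron–Severi group of a Fermat surface,
Progr. Math. 35 (1983), §2 Theorem (𝔅²ₘ) (i); [Aoki1983] N. Aoki, Math. Ann. 266 (1983) §5 Prop. 5.1, §7
Thm. A′; [Aoki1987] N. Aoki, J. Math. Soc. Japan 39 (1987) §1 p. 387; [Shioda1979PJA] T. Shioda, Proc. Japan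
Acad. 55A (1979) §1.
-/

-- D-0017: single-problem summit, `Summit.HodgeConjecture.HodgeConjecture.…` repeats the component by design.
set_option linter.dupNamespace false

noncomputable section

open Finset
open Literature.AlgebraicGeometry.HodgeTheory Literature.AlgebraicGeometry.HodgeTheory.FermatCharacter

namespace Summit.HodgeConjecture.HodgeConjecture.Theorems.CancelByAnyClaimLattice.CoprimeSix

/-! ### The core: six progression points force `σ_{7,A}` -/

/-- **Six points of a `7`-progression force `σ_{7,A}`, abstract form.** Let `s` be a Hodge octuple of
level `m` coprime to `6`, `A, e ∈ ℤ/m` with `7A ≠ 0`, `7e = 0`, such that the progression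
`{A + i e : i < 7}` has no repetition and `σ = {A + i e : i < 7} + {-7A}` is a Hodge multiset. If
`A + j e ∈ s` for all `j < 7`, `j ≠ j₀`, then `s = σ`: `s + (-σ)` minus the six pairs `{A + je, -(A + je)}`
is a Hodge quadruple `{u₁, u₂, -(A + j₀ e), 7A}`, two pairs by Aoki–Shioda; `7A = A + j₀ e` would give
`42 A = 0`, i.e. `7A = 0` as `6` is a unit, so `{u₁, u₂} = {A + j₀ e, -7A}`.
[cite: Aoki1983, §5 Prop. 5.1 and §7 Thm. A′] [cite: AokiShioda1983, §2 Theorem (𝔅²ₘ) (i)] -/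
theorem eq_sigmaSeven_of_fibre {m : ℕ} [NeZero m] (hm : m.Coprime 6) {s : Multiset (ZMod m)}
    (hs : IsHodgeMultiset s) (h8 : Multiset.card s = 8) {A e : ZMod m} (hA : (7 : ZMod m) * A ≠ 0)
    (he7 : (7 : ZMod m) * e = 0)
    (hσ : IsHodgeMultiset ((Multiset.range 7).map (fun i : ℕ ↦ A + (i : ZMod m) * e) + {-((7 : ZMod m) * A)}))
    (hnd : ((Multiset.range 7).map (fun i : ℕ ↦ A + (i : ZMod m) * e)).Nodup)
    {j₀ : ℕ} (hj₀ : j₀ < 7) (hfib : ∀ j : ℕ, j < 7 → j ≠ j₀ → A + (j : ZMod m) * e ∈ s) :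
    s = (Multiset.range 7).map (fun i : ℕ ↦ A + (i : ZMod m) * e) + {-((7 : ZMod m) * A)} := by
  -- adapted from `eq_sigmaFive_of_fibre` (…SigmaFiveOfFibre), `5 ↦ 7`
  classical
  set f : ℕ → ZMod m := fun i ↦ A + (i : ZMod m) * e with hf
  have hfj : f j₀ = A + (j₀ : ZMod m) * e := by rw [hf]
  -- the six progression points lying in `s`
  set F₆ : Multiset (ZMod m) := ((Finset.range 7).erase j₀).val.map f with hF₆
  have hsplit : (Multiset.range 7).map f = f j₀ ::ₘ F₆ := by
    rw [hF₆, ← Multiset.map_cons f j₀, ← Finset.insert_val_of_notMem (Finset.notMem_erase j₀ _),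
      Finset.insert_erase (Finset.mem_range.mpr hj₀), Finset.range_val]
  have hF₆nd : F₆.Nodup := by
    refine Multiset.nodup_of_le ?_ hnd
    rw [hsplit]
    exact Multiset.le_cons_self _ _
  have hF₆s : F₆ ≤ s := by
    refine (Multiset.le_iff_subset hF₆nd).mpr fun x hx ↦ ?_
    obtain ⟨j, hj, rfl⟩ := Multiset.mem_map.mp hx
    rw [Finset.mem_val, Finset.mem_erase, Finset.mem_range] at hj
    exact hfib j hj.2 hj.1
  obtain ⟨u, hsu⟩ := Multiset.le_iff_exists_add.mp hF₆s
  have hF₆card : Multiset.card F₆ = 6 := by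
    rw [hF₆, Multiset.card_map, Finset.card_val, Finset.card_erase_of_mem (Finset.mem_range.mpr hj₀),
      Finset.card_range]
  have hucard : Multiset.card u = 2 := by
    have hc := congrArg Multiset.card hsu
    rw [Multiset.card_add, hF₆card, h8] at hc
    omega
  obtain ⟨u₁, u₂, rfl⟩ := Multiset.card_eq_two.mp hucard
  -- the Hodge quadruple `{u₁, u₂, -(f j₀), 7A}`
  have hF₆0 : ∀ x ∈ F₆, x ≠ 0 := fun x hx ↦ hs.1.1 x (Multiset.mem_of_le hF₆s hx)
  have hpairs : IsHodgeMultiset (F₆ + F₆.map (fun a ↦ -a)) := isHodgeMultiset_add_map_neg hF₆0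
  have hbig : IsHodgeMultiset (s + ((Multiset.range 7).map f + {-((7 : ZMod m) * A)}).map (fun a ↦ -a)) :=
    hs.add (isHodgeMultiset_map_neg hσ)
  have heq : s + ((Multiset.range 7).map f + {-((7 : ZMod m) * A)}).map (fun a ↦ -a) =
      (F₆ + F₆.map (fun a ↦ -a)) + {u₁, u₂, -(f j₀), 7 * A} := by
    rw [hsu, hsplit]
    simp only [Multiset.map_add, Multiset.map_singleton, neg_neg, Multiset.insert_eq_cons,
      ← Multiset.singleton_add]
    abel
  rw [heq] at hbig
  have ht : IsHodgeMultiset ({u₁, u₂, -(f j₀), 7 * A} : Multiset (ZMod m)) := hbig.of_add_left hpairs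
  -- the obstruction: `7A = A + j₀ e` is impossible (`42 A = 6 · 7A = 0`, `6` a unit)
  have hbad : -(f j₀) + 7 * A = 0 → False := by
    intro h
    have h6u : IsUnit ((6 : ℕ) : ZMod m) := by
      rw [ZMod.isUnit_iff_coprime]
      exact hm.symm
    have h42 : ((6 : ℕ) : ZMod m) * (7 * A) = 0 := by
      push_cast
      linear_combination (7 : ZMod m) * h + (7 : ZMod m) * hfj + (j₀ : ZMod m) * he7
    rw [h6u.mul_right_eq_zero] at h42
    exact hA h42
  -- the conclusion, once `{u₁, u₂} = {f j₀, -7A}`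
  have hgoal : ({u₁, u₂} : Multiset (ZMod m)) = {f j₀, -(7 * A)} →
      F₆ + {u₁, u₂} = (Multiset.range 7).map f + {-(7 * A)} := by
    intro h
    rw [h, hsplit, Multiset.insert_eq_cons, Multiset.add_cons, Multiset.cons_add]
  rcases exists_pairing_of_four hm ht with ⟨-, h2⟩ | ⟨h1, h2⟩ | ⟨h1, h2⟩
  · exact (hbad h2).elim
  · rw [hsu]
    apply hgoal
    rw [show u₁ = f j₀ by linear_combination h1, show u₂ = -(7 * A) by linear_combination h2]
  · rw [hsu]
    apply hgoal
    rw [show u₁ = -(7 * A) by linear_combination h1, show u₂ = f j₀ by linear_combination h2,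
      Multiset.pair_comm]

/-! ### The registered stub -/

/-- **G8-L3 `stub_sigmaSeven_of_fibre` — six points of a `7`-progression force `σ_{7,A}`.** If a Hodge
octuple `s` of level `m` coprime to `6`, `7 ∣ m`, contains all but one of the seven points `A + j(m/7)`
(`7A ≠ 0`), then `s` is four pairs or `s = {A + j(m/7) : j < 7} + {-7A}`: the standard multiset
`σ_{7,A}` is Hodge (`isHodgeMultiset_pStandard`, `p = 7 = 2·3+1`), the progression is the fibre of reduction
mod `m/7` (no repetition), `7 · (m/7) = 0`, and `eq_sigmaSeven_of_fibre` applies (the right disjunct always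
holds). [cite: AokiShioda1983, §2 Theorem (𝔅²ₘ) (i)] [cite: Aoki1987, §1 p. 387] -/
theorem stub_sigmaSeven_of_fibre : ∀ (m : ℕ) [NeZero m], m.Coprime 6 → 7 ∣ m → ∀ s : Multiset (ZMod m), IsHodgeMultiset s → Multiset.card s = 8 → ∀ A : ZMod m, (7 : ZMod m) * A ≠ 0 → (∃ j₀ : ℕ, j₀ < 7 ∧ ∀ j : ℕ, j < 7 → j ≠ j₀ → A + (j : ZMod m) * ((m / 7 : ℕ) : ZMod m) ∈ s) → (∃ Q : Multiset (ZMod m), (∀ a ∈ Q, a ≠ 0) ∧ s = Q + Q.map (fun a ↦ -a)) ∨ s = (Multiset.range 7).map (fun i : ℕ ↦ A + (i : ZMod m) * ((m / 7 : ℕ) : ZMod m)) + {-((7 : ZMod m) * A)} := by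
  intro m _ hm h7 s hs h8 A hA hfib
  obtain ⟨j₀, hj₀, hfib⟩ := hfib
  right
  have he7 : (7 : ZMod m) * ((m / 7 : ℕ) : ZMod m) = 0 := by
    have h : ((7 : ℕ) : ZMod m) * ((m / 7 : ℕ) : ZMod m) = 0 := by
      rw [← Nat.cast_mul, Nat.mul_div_cancel' h7, ZMod.natCast_self]
    simpa only [Nat.cast_ofNat] using h
  have hσ : IsHodgeMultiset ((Multiset.range 7).map (fun i : ℕ ↦ A + (i : ZMod m) * ((m / 7 : ℕ) : ZMod m)) +
      {-((7 : ZMod m) * A)}) := by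
    have h := isHodgeMultiset_pStandard (m := m) (p := 7) (r := 3) rfl h7 (a := A) (by exact_mod_cast hA)
    simpa only [Nat.cast_ofNat] using h
  have hnd : ((Multiset.range 7).map (fun i : ℕ ↦ A + (i : ZMod m) * ((m / 7 : ℕ) : ZMod m))).Nodup := by
    rw [range_map_eq_filter_of_dvd_one h7 A]
    exact Finset.nodup _
  exact eq_sigmaSeven_of_fibre hm hs h8 hA he7 hσ hnd hj₀ hfib

end Summit.HodgeConjecture.HodgeConjecture.Theorems.CancelByAnyClaimLattice.CoprimeSix

end
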